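import Mathlib
import HarnessLib
import Summits.QuantumFields.YangMills.Theorems.DirichletWindowXiDivergesOfLocalGaussianity
import Summits.QuantumFields.YangMills.Theorems.DirichletWindowAxialCorrLength

/-!
# The torus–axial re-typing of Chatterjee's Problem 5.1 reduces to its gap core

Ideator seat ym-idea-4 g5 («spectral / trace methods»); registry-hygiene companion to
`NotChatterjeeMassGapProblem*` (rows 5/6 of the strong-hypothesis registry are false AS TYPED:
finite gauge groups, free b.c.). The natural re-typing of Chatterjee, arXiv:1803.01950, Problem 5.1
over the objects of the live routes is the **torus–axial form** `S28ᵀ(G, r)`: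

  (GAP)  for every `β > 0` and every torus-limit state `μ ∈ infiniteVolumeLimitPoints r.ρ β` the
         axial plaquette two-point function `f(n) = plaquetteCorrFn r.ρ μ (n e₀)` is strictly
         positive and has an inverse correlation length `m > 0` (`HasInvCorrLength f m`, i.e.
         `-log f(n e₀)/n → m`), and
  (DIV)  `ξ = 1/m → ∞`: for every `ε > 0`, for all large `β`, every inverse axial correlation
         length of every torus-limit state is `≤ ε`,

for compact simple `G` (`IsCompactSimpleLieGroup G`) and a faithful unitary lattice representation
`r`. This module proves, with both Props INLINED (no definitions are introduced):

* `invCorrLength_le_eventually` — (DIV) HOLDS unconditionally (from the closed item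
  `DirichletWindow.XiDiverges`, `xiDiverges_proof`, and `AxialCorrLength.rateLeOfLowerBound`);
* `s28TorusAxial_iff_gapCore` — `S28ᵀ(G, r)` is EQUIVALENT to its gap core
  `∀ β > 0, ∀ μ, f_{β,μ}(2e₀) ≠ 0 ∧ ∀ m, HasInvCorrLength f m → 0 < m`
  (non-degeneracy at distance two + positivity of the rate), by the reflection-positivity
  dichotomy `AxialCorrLength.axialRateDichotomy` (existence of the rate is free) and (DIV).

So the only open content of the re-typed row is the lattice mass gap `m(β, μ) > 0` at each fixed
`β > 0` (item `LatticeGapLargeBeta`-type statements), exactly as it should be. HONEST SCOPE: torus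
states, axial direction; nothing here proves `m > 0`, a continuum limit, or the summit.
-/

namespace Summit.QuantumFields.YangMills.Theorems.S28TorusAxial

open MeasureTheory Filter Topology
open Literature.MathematicalPhysics.QuantumFieldTheory
open Literature.MathematicalPhysics.QuantumLattice
open Literature.Probability.LatticeModels

/-- From an `XiDiverges`-type lower envelope, any inverse axial correlation length is at most the
envelope rate. -/
theorem invCorrLength_le_of_lowerEnvelope {f : Site 4 → ℝ} {A m' m : ℝ} (hA : 0 < A)
    (hlow : ∀ n : ℕ, A * Real.exp (-(m' * n)) ≤ f ((n : ℤ) • Pi.single (0 : Fin 4) (1 : ℤ)))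
    (hm : HasInvCorrLength f m) : m ≤ m' := by
  have hpos : ∀ n : ℕ, 0 < f ((n : ℤ) • Pi.single (0 : Fin 4) (1 : ℤ)) := fun n =>
    lt_of_lt_of_le (mul_pos hA (Real.exp_pos _)) (hlow n)
  refine AxialCorrLength.rateLeOfLowerBound
    (fun n : ℕ => f ((n : ℤ) • Pi.single (0 : Fin 4) (1 : ℤ))) A m' m hA hlow ?_
  unfold HasInvCorrLength at hm
  refine hm.congr' (Eventually.of_forall fun n => ?_)
  simp only [abs_of_pos (hpos n)]

/-- **(DIV) holds.** For compact simple `G`, faithful unitary `r` and every `ε > 0`: beyond some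
`β₁`, every inverse axial correlation length of every 4-d torus-limit state is `≤ ε`
(«`ξ_axial → ∞` uniformly over limit states», the divergence half of the torus–axial re-typing of
Chatterjee's Problem 5.1; consequence of item 8941). -/
theorem invCorrLength_le_eventually :
    ∀ (G : Type) [Group G] [TopologicalSpace G] [IsTopologicalGroup G] [CompactSpace G]
      [MeasurableSpace G] [BorelSpace G], IsCompactSimpleLieGroup G → ∀ r : LatticeRep G,
      ∀ ε : ℝ, 0 < ε → ∃ β₁ : ℝ, ∀ β : ℝ, β₁ ≤ β →
        ∀ μ ∈ infiniteVolumeLimitPoints (d := 4) r.ρ β,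
          ∀ m : ℝ, HasInvCorrLength (plaquetteCorrFn r.ρ μ) m → m ≤ ε := by
  intro G _ _ _ _ _ _ hG r ε hε
  obtain ⟨β₁, h⟩ := xiDiverges_proof G hG r ε hε
  refine ⟨β₁, fun β hβ μ hμ m hm => ?_⟩
  obtain ⟨m', A, hA, -, hm'ε, hlow⟩ := h β hβ μ hμ
  exact (invCorrLength_le_of_lowerEnvelope hA hlow hm).trans hm'ε

/-- **The torus–axial re-typing of Problem 5.1 is equivalent to its gap core.** For every compact
simple `G` and faithful unitary `r`:
`[(GAP) ∧ (DIV)] ↔ [∀ β > 0, ∀ μ, f_{β,μ}(2e₀) ≠ 0 ∧ ∀ m, HasInvCorrLength f_{β,μ} m → 0 < m]`. -/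
theorem s28TorusAxial_iff_gapCore (G : Type) [Group G] [TopologicalSpace G] [IsTopologicalGroup G]
    [CompactSpace G] [MeasurableSpace G] [BorelSpace G] (hG : IsCompactSimpleLieGroup G)
    (r : LatticeRep G) :
    ((∀ β : ℝ, 0 < β → ∀ μ ∈ infiniteVolumeLimitPoints (d := 4) r.ρ β,
        (∀ n : ℕ, 0 < plaquetteCorrFn r.ρ μ ((n : ℤ) • Pi.single (0 : Fin 4) (1 : ℤ))) ∧
        ∃ m : ℝ, 0 < m ∧ HasInvCorrLength (plaquetteCorrFn r.ρ μ) m) ∧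
      (∀ ε : ℝ, 0 < ε → ∃ β₁ : ℝ, ∀ β : ℝ, β₁ ≤ β →
        ∀ μ ∈ infiniteVolumeLimitPoints (d := 4) r.ρ β,
          ∀ m : ℝ, HasInvCorrLength (plaquetteCorrFn r.ρ μ) m → m ≤ ε)) ↔
    (∀ β : ℝ, 0 < β → ∀ μ ∈ infiniteVolumeLimitPoints (d := 4) r.ρ β,
        plaquetteCorrFn r.ρ μ (((2 : ℕ) : ℤ) • Pi.single (0 : Fin 4) (1 : ℤ)) ≠ 0 ∧
        ∀ m : ℝ, HasInvCorrLength (plaquetteCorrFn r.ρ μ) m → 0 < m) := by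
  constructor
  · rintro ⟨hgap, -⟩ β hβ μ hμ
    obtain ⟨hpos, m₀, hm₀, hinv₀⟩ := hgap β hβ μ hμ
    refine ⟨(hpos 2).ne', fun m hm => ?_⟩
    have : m = m₀ := tendsto_nhds_unique hm hinv₀
    exact this ▸ hm₀
  · intro hcore
    refine ⟨fun β hβ μ hμ => ?_, invCorrLength_le_eventually G hG r⟩
    obtain ⟨h2, hrate⟩ := hcore β hβ μ hμ
    rcases AxialCorrLength.axialRateDichotomy G r.N r.ρ r.continuous β hβ.le μ hμ with
      hzero | ⟨hpos, m, -, hinv, -⟩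
    · exact absurd (hzero 2 le_rfl) h2
    · exact ⟨hpos, m, hrate m hinv, hinv⟩

end Summit.QuantumFields.YangMills.Theorems.S28TorusAxial
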